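import Mathlib
import Summits.KontsevichZagierPeriods.KontsevichZagierPeriods.Theorems.SoloInformedSumPieces
import HarnessLib
import HarnessLib.Audit

/-!
# SoloInformed — shuffles of two chains (THEOREM XL, file 1: combinatorics)

Solo programme `solo-KontsevichZagierPeriods-informed`, session s46. Write `a = p + 2`,
`b = q + 2`, `n = a + b`. In `𝒫 = KZ.FormalPeriodRing` the product `mzvClass [a] * mzvClass [b]` is
the class of the PRODUCT REPRESENTATION `[Δ_a × Δ_b, ω_{0^{a-1}1} ⊗ ω_{0^{b-1}1}]` (Fubini is the
ring structure of `𝒫`). Its domain is the open cube cut by the two chains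
`t₀ > ⋯ > t_{a−1}`, `t_a > ⋯ > t_{n−1}` — an order polytope — and its integrand is the word-product
with the letter `1` exactly at the two chain bottoms `B₁ = a − 1`, `B₂ = n − 1`. The ORDER-CELL
ENGINE (THM XXXVIII) dissects it over the linear extensions `σ` of the two chains (the shuffles),
and each simplex piece is a double zeta value: if `M_σ` is the rank (from the bottom) of the
higher of the two chain minima, the piece of `σ` is `Z(n − M_σ, M_σ)`. Hence

  `mzvClass [a] * mzvClass [b] = ∑_{σ shuffle} mzvClass [n − M_σ, M_σ]`

(`soloInformed_mzvClass_shuffle`), the shuffle product formula between ABSTRACT periods, for all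
`a, b ≥ 2`; the fiberwise form `soloInformed_mzvClass_shuffle_count` exhibits the multiplicities as
cardinalities decided by `decide`, e.g. `ζ(2)ζ(3) = 6ζ(4,1) + 3ζ(3,2) + ζ(2,3)` in `𝒫`
(`soloInformed_mzvClass_shuffle_two_three`; `p = q = 0` is THM XXXII, `ζ(2)² = 4ζ(3,1) + 2ζ(2,2)`).

References: Kontsevich–Zagier 2001 §1.1–1.2 [KontsevichZagier2001]; Zagier 1994 §9; Hoffman 1992
(shuffle algebra); R. Stanley, Two poset polytopes (1986).
-/

noncomputable section

open MeasureTheory Set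
open Literature.ModelTheory.ExponentialFields Literature.NumberTheory.Transcendental
open Literature.NumberTheory.Transcendental.KZ

namespace Summit.KontsevichZagierPeriods.KontsevichZagierPeriods.Theorems

variable {p q : ℕ}

/-! ## 1. The two-chain poset -/

/-- The shuffle poset on `Fin (a + b)`: pairs `(lower, upper)` of the chain `t₀ > ⋯ > t_{a−1}` on
the first block and of the chain `t_a > ⋯ > t_{a+b−1}` on the second block. -/
def soloInformedShPoset (p q : ℕ) : List (Fin (p + 2 + (q + 2)) × Fin (p + 2 + (q + 2))) :=
  (List.finRange (p + 1)).map
      (fun i => (Fin.castAdd (q + 2) i.succ, Fin.castAdd (q + 2) (Fin.castSucc i))) ++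
    (List.finRange (q + 1)).map
      (fun j => (Fin.natAdd (p + 2) j.succ, Fin.natAdd (p + 2) (Fin.castSucc j)))

/-- Membership in the order polytope of the shuffle poset. -/
theorem soloInformed_mem_shOrderSet {z : Fin (p + 2 + (q + 2)) → ℝ} :
    z ∈ soloInformedOrderSet (soloInformedShPoset p q) ↔
      (∀ i : Fin (p + 1), z (Fin.castAdd (q + 2) i.succ) < z (Fin.castAdd (q + 2) (Fin.castSucc i))) ∧
        ∀ j : Fin (q + 1), z (Fin.natAdd (p + 2) j.succ) < z (Fin.natAdd (p + 2) (Fin.castSucc j)) := by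
  constructor
  · intro h
    exact ⟨fun i => h _ (List.mem_append_left _ (List.mem_map.2 ⟨i, List.mem_finRange i, rfl⟩)),
      fun j => h _ (List.mem_append_right _ (List.mem_map.2 ⟨j, List.mem_finRange j, rfl⟩))⟩
  · rintro ⟨h1, h2⟩ c hc
    rcases List.mem_append.1 hc with hc | hc
    · obtain ⟨i, -, rfl⟩ := List.mem_map.1 hc
      exact h1 i
    · obtain ⟨j, -, rfl⟩ := List.mem_map.1 hc
      exact h2 j

/-- The bottom `B₁ = a − 1` of the first chain. -/
def soloInformedShB1 (p q : ℕ) : Fin (p + 2 + (q + 2)) := Fin.castAdd (q + 2) (Fin.last (p + 1))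

/-- The bottom `B₂ = a + b − 1` of the second chain. -/
def soloInformedShB2 (p q : ℕ) : Fin (p + 2 + (q + 2)) := Fin.natAdd (p + 2) (Fin.last (q + 1))

/-- Auxiliary (shuffle): the value of `B₁`. -/
@[simp] theorem soloInformed_shB1_val : (soloInformedShB1 p q : ℕ) = p + 1 := by
  simp [soloInformedShB1]

/-- Auxiliary (shuffle): the value of `B₂`. -/
@[simp] theorem soloInformed_shB2_val : (soloInformedShB2 p q : ℕ) = p + q + 3 := by
  simp [soloInformedShB2]; omega

/-- The two chain bottoms are distinct. -/
theorem soloInformed_shB1_ne_shB2 : soloInformedShB1 p q ≠ soloInformedShB2 p q := by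
  intro h
  have := congrArg Fin.val h
  simp at this
  omega

/-! ## 2. The product of two simplices is the cube cut by the two chains -/

/-- `Δ_a × Δ_b = (0,1)ⁿ ∩ P_E` for the shuffle poset `E`. -/
theorem soloInformed_prodSimplex_eq :
    {z : Fin (p + 2 + (q + 2)) → ℝ |
        (fun i => z (Fin.castAdd (q + 2) i)) ∈ openOrderedSimplex (p + 2) ∧
          (fun j => z (Fin.natAdd (p + 2) j)) ∈ openOrderedSimplex (q + 2)} =
      soloInformedOpenCube (p + 2 + (q + 2)) ∩ soloInformedOrderSet (soloInformedShPoset p q) := by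
  ext z
  simp only [mem_setOf_eq, openOrderedSimplex, mem_inter_iff, soloInformed_mem_openCube_iff,
    soloInformed_mem_shOrderSet, Fin.strictAnti_iff_succ_lt]
  constructor
  · rintro ⟨⟨ha0, ha1, ha⟩, hb0, hb1, hb⟩
    refine ⟨fun k => ?_, ha, hb⟩
    induction k using Fin.addCases with
    | left i => exact ⟨ha0 i, ha1 i⟩
    | right j => exact ⟨hb0 j, hb1 j⟩
  · rintro ⟨hc, ha, hb⟩
    exact ⟨⟨fun i => (hc _).1, fun i => (hc _).2, ha⟩, fun j => (hc _).1, fun j => (hc _).2, hb⟩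

/-! ## 3. Letters and words -/

/-- The letter vector of the product integrand: `1` exactly at the two chain bottoms. -/
def soloInformedShEps (p q : ℕ) : Fin (p + 2 + (q + 2)) → Bool :=
  Fin.append (fun i : Fin (p + 2) => decide (i = Fin.last (p + 1)))
    (fun j : Fin (q + 2) => decide (j = Fin.last (q + 1)))

/-- The letters on the first block. -/
theorem soloInformed_shEps_castAdd (i : Fin (p + 2)) :
    soloInformedShEps p q (Fin.castAdd (q + 2) i) = decide (i = Fin.last (p + 1)) := by
  simp [soloInformedShEps]

/-- The letters on the second block. -/
theorem soloInformed_shEps_natAdd (j : Fin (q + 2)) :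
    soloInformedShEps p q (Fin.natAdd (p + 2) j) = decide (j = Fin.last (q + 1)) := by
  simp [soloInformedShEps]

/-- `ε_k = 1 ⟺ k` is one of the two chain bottoms. -/
theorem soloInformed_shEps_iff (k : Fin (p + 2 + (q + 2))) :
    soloInformedShEps p q k = true ↔ k = soloInformedShB1 p q ∨ k = soloInformedShB2 p q := by
  rw [Fin.ext_iff, Fin.ext_iff, soloInformed_shB1_val, soloInformed_shB2_val]
  induction k using Fin.addCases with
  | left i =>
    have := i.2
    rw [soloInformed_shEps_castAdd, decide_eq_true_eq, Fin.ext_iff, Fin.val_last, Fin.val_castAdd]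
    omega
  | right j =>
    have := j.2
    rw [soloInformed_shEps_natAdd, decide_eq_true_eq, Fin.ext_iff, Fin.val_last, Fin.val_natAdd]
    omega

/-- **The word of `Z(a)`**: the single letter `1` at position `a − 1`. -/
theorem soloInformed_binaryWord_single_getD (a k : ℕ) :
    (MZV.binaryWord [a]).getD k false = decide (k = a - 1) := by
  have hw : MZV.binaryWord [a] = List.replicate (a - 1) false ++ [true] := by simp [MZV.binaryWord]
  rw [hw, soloInformed_getD_replicate_false_append]
  split_ifs with h1
  · symm; simp only [decide_eq_false_iff_not]; omega
  · rcases Nat.eq_zero_or_eq_succ_pred (k - (a - 1)) with h2 | h2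
    · rw [h2, List.getD_cons_zero]; symm; simp only [decide_eq_true_eq]; omega
    · rw [h2, List.getD_cons_succ, List.getD_nil]; symm
      simp only [decide_eq_false_iff_not]; omega

/-- The tensor product of the two one-letter word-products is the word-product of `ε`. -/
theorem soloInformed_shWordProd (z : Fin (p + 2 + (q + 2)) → ℝ) :
    (∏ i : Fin (p + 2), mzvForm ((MZV.binaryWord [p + 2]).getD i false) (z (Fin.castAdd (q + 2) i))) *
        (∏ j : Fin (q + 2), mzvForm ((MZV.binaryWord [q + 2]).getD j false) (z (Fin.natAdd (p + 2) j))) =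
      ∏ k : Fin (p + 2 + (q + 2)), mzvForm (soloInformedShEps p q k) (z k) := by
  rw [Fin.prod_univ_add (fun k : Fin (p + 2 + (q + 2)) => mzvForm (soloInformedShEps p q k) (z k))]
  congr 1
  · refine Finset.prod_congr rfl fun i _ => ?_
    rw [soloInformed_shEps_castAdd, soloInformed_binaryWord_single_getD]
    congr 1
    exact decide_eq_decide.mpr (by rw [Fin.ext_iff, Fin.val_last]; omega)
  · refine Finset.prod_congr rfl fun j _ => ?_
    rw [soloInformed_shEps_natAdd, soloInformed_binaryWord_single_getD]
    congr 1
    exact decide_eq_decide.mpr (by rw [Fin.ext_iff, Fin.val_last]; omega)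

/-! ## 4. Linear extensions of the two chains (shuffles) -/

section Compat

variable {σ : Equiv.Perm (Fin (p + 2 + (q + 2)))}

/-- Compatibility along the first chain. -/
theorem soloInformed_shCompat_left (hσ : soloInformedCompat (soloInformedShPoset p q) σ)
    (i : Fin (p + 1)) :
    σ.symm (Fin.castAdd (q + 2) i.succ) < σ.symm (Fin.castAdd (q + 2) (Fin.castSucc i)) :=
  hσ _ (List.mem_append_left _ (List.mem_map.2 ⟨i, List.mem_finRange i, rfl⟩))

/-- Compatibility along the second chain. -/
theorem soloInformed_shCompat_right (hσ : soloInformedCompat (soloInformedShPoset p q) σ)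
    (j : Fin (q + 1)) :
    σ.symm (Fin.natAdd (p + 2) j.succ) < σ.symm (Fin.natAdd (p + 2) (Fin.castSucc j)) :=
  hσ _ (List.mem_append_right _ (List.mem_map.2 ⟨j, List.mem_finRange j, rfl⟩))

/-- **The minimum of a shuffle is one of the two chain bottoms**: `rank B₁ = 0 ∨ rank B₂ = 0`. -/
theorem soloInformed_shCompat_bottom (hσ : soloInformedCompat (soloInformedShPoset p q) σ) :
    (σ.symm (soloInformedShB1 p q) : ℕ) = 0 ∨ (σ.symm (soloInformedShB2 p q) : ℕ) = 0 := by
  obtain ⟨k, hk⟩ : ∃ k, σ.symm k = ⟨0, by omega⟩ := ⟨σ ⟨0, by omega⟩, by simp⟩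
  induction k using Fin.addCases with
  | left i =>
    by_cases hi : (i : ℕ) = p + 1
    · left
      have e : Fin.castAdd (q + 2) i = soloInformedShB1 p q := Fin.ext (by simpa using hi)
      rw [← e, hk]
    · exfalso
      have hlt := soloInformed_shCompat_left hσ ⟨i, by omega⟩
      have e : Fin.castSucc (⟨i, by omega⟩ : Fin (p + 1)) = i := Fin.ext rfl
      rw [e, hk] at hlt
      exact Nat.not_lt_zero _ (Fin.lt_def.1 hlt)
  | right j =>
    by_cases hj : (j : ℕ) = q + 1
    · right
      have e : Fin.natAdd (p + 2) j = soloInformedShB2 p q := Fin.ext (by simp; omega)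
      rw [← e, hk]
    · exfalso
      have hlt := soloInformed_shCompat_right hσ ⟨j, by omega⟩
      have e : Fin.castSucc (⟨j, by omega⟩ : Fin (q + 1)) = j := Fin.ext rfl
      rw [e, hk] at hlt
      exact Nat.not_lt_zero _ (Fin.lt_def.1 hlt)

/-- **Neither chain bottom is the maximum of a shuffle.** -/
theorem soloInformed_shCompat_lt (hσ : soloInformedCompat (soloInformedShPoset p q) σ) :
    (σ.symm (soloInformedShB1 p q) : ℕ) < p + q + 3 ∧ (σ.symm (soloInformedShB2 p q) : ℕ) < p + q + 3 := by
  constructor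
  · have h := soloInformed_shCompat_left hσ (Fin.last p)
    have e : Fin.castAdd (q + 2) (Fin.last p).succ = soloInformedShB1 p q := Fin.ext (by simp)
    rw [e] at h
    have := (σ.symm (Fin.castAdd (q + 2) (Fin.castSucc (Fin.last p)))).2
    have h' := Fin.lt_def.1 h
    omega
  · have h := soloInformed_shCompat_right hσ (Fin.last q)
    have e : Fin.natAdd (p + 2) (Fin.last q).succ = soloInformedShB2 p q := Fin.ext (by simp; omega)
    rw [e] at h
    have := (σ.symm (Fin.natAdd (p + 2) (Fin.castSucc (Fin.last q)))).2
    have h' := Fin.lt_def.1 h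
    omega

/-- The rank (from the bottom, `0`-based) of the higher of the two chain minima. -/
def soloInformedShM (σ : Equiv.Perm (Fin (p + 2 + (q + 2)))) : ℕ :=
  max (σ.symm (soloInformedShB1 p q) : ℕ) (σ.symm (soloInformedShB2 p q) : ℕ)

/-- The two ranks differ. -/
theorem soloInformed_shRank_ne :
    (σ.symm (soloInformedShB1 p q) : ℕ) ≠ (σ.symm (soloInformedShB2 p q) : ℕ) :=
  fun e => soloInformed_shB1_ne_shB2 (σ.symm.injective (Fin.ext e))

/-- `1 ≤ M_σ ≤ a + b − 2` for a shuffle. -/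
theorem soloInformed_shM_bounds (hσ : soloInformedCompat (soloInformedShPoset p q) σ) :
    1 ≤ soloInformedShM σ ∧ soloInformedShM σ ≤ p + q + 2 := by
  have h1 := soloInformed_shRank_ne (σ := σ)
  have h2 := soloInformed_shCompat_lt hσ
  unfold soloInformedShM
  rcases le_total (σ.symm (soloInformedShB1 p q) : ℕ) (σ.symm (soloInformedShB2 p q) : ℕ) with h | h
  · rw [max_eq_right h]; omega
  · rw [max_eq_left h]; omega

/-- `{rank B₁, rank B₂} = {M_σ, 0}`. -/
theorem soloInformed_shRanks (hσ : soloInformedCompat (soloInformedShPoset p q) σ) (t : ℕ) :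
    (t = (σ.symm (soloInformedShB1 p q) : ℕ) ∨ t = (σ.symm (soloInformedShB2 p q) : ℕ)) ↔
      (t = soloInformedShM σ ∨ t = 0) := by
  have h1 := soloInformed_shCompat_bottom hσ
  unfold soloInformedShM
  rcases le_total (σ.symm (soloInformedShB1 p q) : ℕ) (σ.symm (soloInformedShB2 p q) : ℕ) with h | h
  · rw [max_eq_right h]; omega
  · rw [max_eq_left h]; omega

/-- **The letters in slot coordinates**: after the sorting permutation `rev ∘ σ⁻¹` the two letters
`1` sit at the slots `a + b − 1 − M_σ` and `a + b − 1`. -/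
theorem soloInformed_shSlot_iff (hσ : soloInformedCompat (soloInformedShPoset p q) σ)
    (i : Fin (p + 2 + (q + 2))) :
    soloInformedShEps p q i = true ↔
      ((soloInformedCellPerm σ i : ℕ) = p + q + 3 - soloInformedShM σ ∨
        (soloInformedCellPerm σ i : ℕ) = p + q + 3) := by
  rw [soloInformed_shEps_iff]
  have hv : (soloInformedCellPerm σ i : ℕ) = p + q + 3 - (σ.symm i : ℕ) := by
    simp [soloInformedCellPerm]; omega
  have hr := soloInformed_shRanks hσ (σ.symm i : ℕ)
  have hlt := (σ.symm i).2
  have hM := soloInformed_shM_bounds hσ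
  have e1 : i = soloInformedShB1 p q ↔ (σ.symm i : ℕ) = (σ.symm (soloInformedShB1 p q) : ℕ) := by
    rw [← Fin.ext_iff, Equiv.apply_eq_iff_eq]
  have e2 : i = soloInformedShB2 p q ↔ (σ.symm i : ℕ) = (σ.symm (soloInformedShB2 p q) : ℕ) := by
    rw [← Fin.ext_iff, Equiv.apply_eq_iff_eq]
  rw [e1, e2, hv]
  omega

end Compat

end Summit.KontsevichZagierPeriods.KontsevichZagierPeriods.Theorems
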